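import Summits.ValiantsHypothesis.ValiantsHypothesis.Theorems.SymPencilPerFourWcolHyperplaneFiveTools
import Summits.ValiantsHypothesis.ValiantsHypothesis.Theorems.SymPencilPerFourWcolHyperplaneFiveCore
import Summits.ValiantsHypothesis.ValiantsHypothesis.Theorems.SymPencilSingFiveBricksFive

/-!
# Route `SymPencil` — row `r = 11` of the size-`28` table, LEAF E AT FIVE SQUARES:
# a `5`-dimensional `W ⊆ W_col(p,q;m)` carries no joint family of five squares
# (`--supports` stmt-ValiantsHypothesis-5674 `SdcSuperquadratic`; rung currency only)

The size-`27` leaf E (✓ `…SingFiveLeafWcol.wcolFive`) needs the per-POINT rank `≤ 4`, which is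
empty for five squares.  This file replaces it at five squares, for the JOINT family:

* a zero weight makes the family a joint family of FOUR squares — ✓ `noJointFamily_five_four`
  (`Sing3 W` is derived from the two dead rows, ✓ `sing3_of_twoDeadRows`);
* all weights non-zero: transport `(p,q,m) ↦ (0,1,3)` keeping the weights
  (✓ `jointFamily_map_prodCongr_weights`); `W` is the hyperplane `θ^⊥` of `W_col(0,1;3)`
  (✓ `exists_wcol_functional`); the TORUS case (`θ_a = 0` or `θ_b = 0` on the live columns) is
  `VTorusType W` (✓ `vTorusType_of_wcol_functional`) and dies by
  ★ `…SingFiveBricksFive.torusDispatch_five`; the NON-TORUS case picks a zero slot and weights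
  `(λ, μ)` by pigeonhole (`exists_slot`, `exists_weights` — by cases on supports, no «wlog»),
  permutes the live columns (`noJointFive_wcol_slot`) and dies by
  ★ `…WcolHyperplaneFiveCore.noJointFive_wcol_core` (the radical-line argument).

Main statement: `noJointFive_of_inWCol` (binders of ✓ `wcolFive` with the joint five family in
place of `PerPointFour`; no `Sing3` binder); `noJointFive_of_inWCol'` takes `InWCol W p q m`.

Honest framing: a lemma towards row `r = 11` (OPEN) of the size-`28` table; nothing about the
determinantal complexity of `per_4` is claimed here; stmt-5674 `SdcSuperquadratic` OPEN;
`VP ≠ VNP` not moved.  No definitions, no named facts. [folklore]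
-/

noncomputable section

-- single-conjunct layout: Sub = Summit, duplicated namespace component intended
set_option linter.dupNamespace false

namespace Summit.ValiantsHypothesis.ValiantsHypothesis.Theorems.SymPencilPerFourWcolHyperplaneFive

open MvPolynomial Module Matrix
open Literature.Computability.AlgebraicComplexity
open Summit.ValiantsHypothesis.ValiantsHypothesis.Theorems
open Summit.ValiantsHypothesis.ValiantsHypothesis.Theorems.SymPencilSingSixClassification
open Summit.ValiantsHypothesis.ValiantsHypothesis.Theorems.SymPencilSingFiveClassification
open Summit.ValiantsHypothesis.ValiantsHypothesis.Theorems.SymPencilPerFourWcolHyperplaneFiveTools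
open Summit.ValiantsHypothesis.ValiantsHypothesis.Theorems.SymPencilPerFourWcolHyperplaneFiveCore
open Summit.ValiantsHypothesis.ValiantsHypothesis.Theorems.SymPencilSingFiveBricksFive

universe u

variable {K : Type u} [Field K]

/-! ## The non-torus case: slot, weights, column permutation -/

/-- **A good zero slot** (pigeonhole, no «wlog»): for `θ_a, θ_b ≠ 0` on the three live columns
there is a column permutation `π` fixing `3` with `(θ_a(π1), θ_a(π2)) ≠ 0 ≠ (θ_b(π1), θ_b(π2))`
(a non-zero `θ` is supported on the single slot `π 0` for at most one of the three choices).
[folklore] -/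
theorem exists_slot (θa θb : Fin 4 → K) (ha : ¬ (θa 0 = 0 ∧ θa 1 = 0 ∧ θa 2 = 0))
    (hb : ¬ (θb 0 = 0 ∧ θb 1 = 0 ∧ θb 2 = 0)) :
    ∃ π : Equiv.Perm (Fin 4), π 3 = 3 ∧ ¬ (θa (π 1) = 0 ∧ θa (π 2) = 0) ∧
      ¬ (θb (π 1) = 0 ∧ θb (π 2) = 0) := by
  classical
  by_cases h1 : ¬ (θa 1 = 0 ∧ θa 2 = 0) ∧ ¬ (θb 1 = 0 ∧ θb 2 = 0)
  · exact ⟨Equiv.refl _, rfl, h1.1, h1.2⟩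
  by_cases h2 : ¬ (θa 0 = 0 ∧ θa 2 = 0) ∧ ¬ (θb 0 = 0 ∧ θb 2 = 0)
  · have s1 : Equiv.swap (0 : Fin 4) 1 1 = 0 := by decide
    have s2 : Equiv.swap (0 : Fin 4) 1 2 = 2 := by decide
    have s3 : Equiv.swap (0 : Fin 4) 1 3 = 3 := by decide
    refine ⟨Equiv.swap 0 1, s3, ?_, ?_⟩
    · rw [s1, s2]; exact h2.1
    · rw [s1, s2]; exact h2.2
  have s1 : Equiv.swap (0 : Fin 4) 2 1 = 1 := by decide
  have s2 : Equiv.swap (0 : Fin 4) 2 2 = 0 := by decide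
  have s3 : Equiv.swap (0 : Fin 4) 2 3 = 3 := by decide
  refine ⟨Equiv.swap 0 2, s3, ?_, ?_⟩
  · rw [s1, s2]; tauto
  · rw [s1, s2]; tauto

/-- **Good weights** (pigeonhole in characteristic `0`): for `(a₁,a₂) ≠ 0 ≠ (b₁,b₂)` one of
`(λ,μ) ∈ {(1,1),(1,2),(2,1)}` has `a₁λ ≠ a₂μ` and `b₁λ ≠ b₂μ` (a non-zero pair is «bad» at no two
of the three ratios). [folklore] -/
theorem exists_weights [CharZero K] (a₁ a₂ b₁ b₂ : K) (ha : ¬ (a₁ = 0 ∧ a₂ = 0))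
    (hb : ¬ (b₁ = 0 ∧ b₂ = 0)) :
    ∃ la mu : K, la ≠ 0 ∧ mu ≠ 0 ∧ a₁ * la - a₂ * mu ≠ 0 ∧ b₁ * la - b₂ * mu ≠ 0 := by
  have two : (2 : K) ≠ 0 := two_ne_zero
  have three : (3 : K) ≠ 0 := three_ne_zero
  -- two bad ratios force the pair to vanish
  have key : ∀ x₁ x₂ : K, ¬ (x₁ = 0 ∧ x₂ = 0) →
      (x₁ * 1 - x₂ * 1 = 0 → x₁ * 1 - x₂ * 2 ≠ 0) ∧ (x₁ * 1 - x₂ * 1 = 0 → x₁ * 2 - x₂ * 1 ≠ 0) ∧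
      (x₁ * 1 - x₂ * 2 = 0 → x₁ * 2 - x₂ * 1 ≠ 0) := by
    intro x₁ x₂ hx
    refine ⟨fun h h' => hx ⟨?_, ?_⟩, fun h h' => hx ⟨?_, ?_⟩, fun h h' => hx ⟨?_, ?_⟩⟩
    · linear_combination 2 * h - h'
    · linear_combination h - h'
    · linear_combination h' - h
    · linear_combination h' - 2 * h
    · have h3 : (3 : K) * x₂ = 0 := by linear_combination h' - 2 * h
      have hx₂ : x₂ = 0 := (mul_eq_zero.1 h3).resolve_left three
      linear_combination h + 2 * hx₂
    · have h3 : (3 : K) * x₂ = 0 := by linear_combination h' - 2 * h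
      exact (mul_eq_zero.1 h3).resolve_left three
  obtain ⟨ka1, ka2, ka3⟩ := key a₁ a₂ ha
  obtain ⟨kb1, kb2, kb3⟩ := key b₁ b₂ hb
  by_cases hA : a₁ * 1 - a₂ * 1 = 0
  · by_cases hB : b₁ * 1 - b₂ * 2 = 0
    · exact ⟨2, 1, two, one_ne_zero, ka2 hA, kb3 hB⟩
    · exact ⟨1, 2, one_ne_zero, two, ka1 hA, hB⟩
  · by_cases hB : b₁ * 1 - b₂ * 1 = 0
    · by_cases hA' : a₁ * 1 - a₂ * 2 = 0
      · exact ⟨2, 1, two, one_ne_zero, ka3 hA', kb2 hB⟩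
      · exact ⟨1, 2, one_ne_zero, two, hA', kb1 hB⟩
    · exact ⟨1, 1, one_ne_zero, one_ne_zero, hA, hB⟩

/-- **The non-torus case in a given slot**: permute the live columns by `π` (`π 3 = 3`) keeping
the weights, and apply ★ `noJointFive_wcol_core` to `Φ(W)` with `θ ∘ π`. [folklore] -/
theorem noJointFive_wcol_slot [CharZero K] (W : Submodule K (Fin 4 × Fin 4 → K))
    (h5 : finrank K W = 5)
    (hWc : ∀ x ∈ W, (∀ j, x (2, j) = 0) ∧ (∀ j, x (3, j) = 0) ∧ x (0, 3) = 0 ∧ x (1, 3) = 0)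
    (θa θb : Fin 4 → K)
    (hWθ : ∀ x : Fin 4 × Fin 4 → K, (∀ j, x (2, j) = 0) → (∀ j, x (3, j) = 0) → x (0, 3) = 0 →
      x (1, 3) = 0 → θa 0 * x (0, 0) + θa 1 * x (0, 1) + θa 2 * x (0, 2) +
        (θb 0 * x (1, 0) + θb 1 * x (1, 1) + θb 2 * x (1, 2)) = 0 → x ∈ W)
    (hθW : ∀ x ∈ W, θa 0 * x (0, 0) + θa 1 * x (0, 1) + θa 2 * x (0, 2) +
        (θb 0 * x (1, 0) + θb 1 * x (1, 1) + θb 2 * x (1, 2)) = 0)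
    (π : Equiv.Perm (Fin 4)) (hπ : π 3 = 3)
    (la mu : K) (hla : la ≠ 0) (hmu : mu ≠ 0) (hA : θa (π 1) * la - θa (π 2) * mu ≠ 0)
    (hB : θb (π 1) * la - θb (π 2) * mu ≠ 0)
    (c : Fin 5 → K) (hc : ∀ k, c k ≠ 0)
    (β : Fin 5 → ((Fin 4 × Fin 4 → K) →ₗ[K] (Fin 4 × Fin 4 → K) →ₗ[K] K))
    (hfam : ∀ u : Fin 4 × Fin 4 → K, ∀ y ∈ W, ∃ e₀ e₁ : K, ∀ s : K,
      eval (u + s • y) (perPoly (Fin 4) K) = e₀ + s * e₁ + s ^ 2 * ∑ k, c k * (β k u y) ^ 2) :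
    False := by
  classical
  -- the reindexing identity on the live columns
  have key : ∀ x : Fin 4 × Fin 4 → K, x (0, 3) = 0 → x (1, 3) = 0 →
      θa (π 0) * x (0, π 0) + θa (π 1) * x (0, π 1) + θa (π 2) * x (0, π 2) +
        (θb (π 0) * x (1, π 0) + θb (π 1) * x (1, π 1) + θb (π 2) * x (1, π 2)) =
      θa 0 * x (0, 0) + θa 1 * x (0, 1) + θa 2 * x (0, 2) +
        (θb 0 * x (1, 0) + θb 1 * x (1, 1) + θb 2 * x (1, 2)) := by
    intro x h03 h13
    have ha := Equiv.sum_comp π (fun j => θa j * x (0, j))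
    have hb := Equiv.sum_comp π (fun j => θb j * x (1, j))
    simp only [Fin.sum_univ_four, hπ, h03, h13, mul_zero, add_zero] at ha hb
    linear_combination ha + hb
  set Φ : (Fin 4 × Fin 4 → K) ≃ₗ[K] (Fin 4 × Fin 4 → K) :=
    LinearEquiv.funCongrLeft K K (Equiv.prodCongr (Equiv.refl (Fin 4)) π) with hΦ
  have hΦa : ∀ (x : Fin 4 × Fin 4 → K) (i j : Fin 4), Φ x (i, j) = x (i, π j) := fun x i j => rfl
  set W' := W.map Φ.toLinearMap with hW'def
  have hfin : finrank K W' = 5 := by rw [hW'def, LinearEquiv.finrank_map_eq, h5]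
  have hWc' : ∀ y ∈ W', (∀ j, y (2, j) = 0) ∧ (∀ j, y (3, j) = 0) ∧ y (0, 3) = 0 ∧
      y (1, 3) = 0 := by
    rintro _ ⟨x, hx, rfl⟩
    obtain ⟨h2, h3, h03, h13⟩ := hWc x hx
    refine ⟨fun j => ?_, fun j => ?_, ?_, ?_⟩
    · show Φ x (2, j) = 0
      rw [hΦa]; exact h2 _
    · show Φ x (3, j) = 0
      rw [hΦa]; exact h3 _
    · show Φ x (0, 3) = 0
      rw [hΦa, hπ]; exact h03
    · show Φ x (1, 3) = 0
      rw [hΦa, hπ]; exact h13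
  have hθW' : ∀ y ∈ W', (fun j => θa (π j)) 0 * y (0, 0) + (fun j => θa (π j)) 1 * y (0, 1) +
      (fun j => θa (π j)) 2 * y (0, 2) + ((fun j => θb (π j)) 0 * y (1, 0) +
      (fun j => θb (π j)) 1 * y (1, 1) + (fun j => θb (π j)) 2 * y (1, 2)) = 0 := by
    rintro _ ⟨x, hx, rfl⟩
    obtain ⟨-, -, h03, h13⟩ := hWc x hx
    show θa (π 0) * Φ x (0, 0) + θa (π 1) * Φ x (0, 1) + θa (π 2) * Φ x (0, 2) +
      (θb (π 0) * Φ x (1, 0) + θb (π 1) * Φ x (1, 1) + θb (π 2) * Φ x (1, 2)) = 0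
    simp only [hΦa]
    rw [key x h03 h13]
    exact hθW x hx
  have hWθ' : ∀ y : Fin 4 × Fin 4 → K, (∀ j, y (2, j) = 0) → (∀ j, y (3, j) = 0) → y (0, 3) = 0 →
      y (1, 3) = 0 → (fun j => θa (π j)) 0 * y (0, 0) + (fun j => θa (π j)) 1 * y (0, 1) +
        (fun j => θa (π j)) 2 * y (0, 2) + ((fun j => θb (π j)) 0 * y (1, 0) +
        (fun j => θb (π j)) 1 * y (1, 1) + (fun j => θb (π j)) 2 * y (1, 2)) = 0 → y ∈ W' := by
    intro y h2 h3 h03 h13 hS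
    obtain ⟨x, hxdef⟩ : ∃ x : Fin 4 × Fin 4 → K, ∀ p, x p = y (p.1, π.symm p.2) :=
      ⟨fun p => y (p.1, π.symm p.2), fun _ => rfl⟩
    have hΦx : Φ x = y := by
      ext ⟨i, j⟩
      rw [hΦa, hxdef]
      simp only [Equiv.symm_apply_apply]
    have hπs : π.symm 3 = 3 := by rw [Equiv.symm_apply_eq]; exact hπ.symm
    have hx03 : x (0, 3) = 0 := by rw [hxdef]; simp only [hπs]; exact h03
    have hx13 : x (1, 3) = 0 := by rw [hxdef]; simp only [hπs]; exact h13
    have hxW : x ∈ W := by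
      refine hWθ x (fun j => by rw [hxdef]; exact h2 _) (fun j => by rw [hxdef]; exact h3 _)
        hx03 hx13 ?_
      rw [← key x hx03 hx13]
      have h := hS
      rw [← hΦx] at h
      simp only [hΦa] at h
      exact h
    exact ⟨x, hxW, hΦx⟩
  obtain ⟨β', hfam'⟩ := jointFamily_map_prodCongr_weights W (Equiv.refl (Fin 4)) π c β hfam
  exact noJointFive_wcol_core W' hfin hWc' (fun j => θa (π j)) (fun j => θb (π j)) hWθ' hθW'
    la mu hla hmu hA hB c hc β' hfam'

/-! ## Leaf E at five squares -/

/-- **Leaf E at five, normal position, non-zero weights**: a `5`-dimensional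
`W ⊆ W_col(0,1;3)` carries no joint family of five squares with all weights non-zero.
[folklore] -/
theorem noJointFive_wcol01_of_ne [CharZero K] (W : Submodule K (Fin 4 × Fin 4 → K))
    (h5 : finrank K W = 5)
    (hWc : ∀ x ∈ W, (∀ j, x (2, j) = 0) ∧ (∀ j, x (3, j) = 0) ∧ x (0, 3) = 0 ∧ x (1, 3) = 0)
    (c : Fin 5 → K) (hc : ∀ k, c k ≠ 0)
    (β : Fin 5 → ((Fin 4 × Fin 4 → K) →ₗ[K] (Fin 4 × Fin 4 → K) →ₗ[K] K))
    (hfam : ∀ u : Fin 4 × Fin 4 → K, ∀ y ∈ W, ∃ e₀ e₁ : K, ∀ s : K,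
      eval (u + s • y) (perPoly (Fin 4) K) = e₀ + s * e₁ + s ^ 2 * ∑ k, c k * (β k u y) ^ 2) :
    False := by
  obtain ⟨θa, θb, hne, hθW, hWθ⟩ := exists_wcol_functional W h5 hWc
  by_cases htor : (θa 0 = 0 ∧ θa 1 = 0 ∧ θa 2 = 0) ∨ (θb 0 = 0 ∧ θb 1 = 0 ∧ θb 2 = 0)
  · exact torusDispatch_five W (vTorusType_of_wcol_functional W hWc θa θb hθW hWθ hne htor)
      c β hfam
  · have ha : ¬ (θa 0 = 0 ∧ θa 1 = 0 ∧ θa 2 = 0) := fun h => htor (Or.inl h)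
    have hb : ¬ (θb 0 = 0 ∧ θb 1 = 0 ∧ θb 2 = 0) := fun h => htor (Or.inr h)
    obtain ⟨π, hπ, hsa, hsb⟩ := exists_slot θa θb ha hb
    obtain ⟨la, mu, hla, hmu, hA, hB⟩ :=
      exists_weights (θa (π 1)) (θa (π 2)) (θb (π 1)) (θb (π 2)) hsa hsb
    exact noJointFive_wcol_slot W h5 hWc θa θb hWθ hθW π hπ la mu hla hmu hA hB c hc β hfam

/-- ★ **Leaf E at five squares** (binders of ✓ `wcolFive`, the joint five family in place of
`PerPointFour`): a `5`-dimensional `W ⊆ W_col(p,q;m)` (`p ≠ q`) carries no joint family of five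
squares. [folklore] -/
theorem noJointFive_of_inWCol [CharZero K] (W : Submodule K (Fin 4 × Fin 4 → K))
    (h5 : finrank K W = 5) (p q m : Fin 4) (hpq : p ≠ q)
    (hcol : ∀ x ∈ W, (∀ i j : Fin 4, i ≠ p → i ≠ q → x (i, j) = 0) ∧ x (p, m) = 0 ∧ x (q, m) = 0)
    (c : Fin 5 → K) (β : Fin 5 → ((Fin 4 × Fin 4 → K) →ₗ[K] (Fin 4 × Fin 4 → K) →ₗ[K] K)) :
    ¬ (∀ u : Fin 4 × Fin 4 → K, ∀ y ∈ W, ∃ e₀ e₁ : K, ∀ s : K,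
      eval (u + s • y) (perPoly (Fin 4) K) = e₀ + s * e₁ + s ^ 2 * ∑ k, c k * (β k u y) ^ 2) := by
  classical
  intro hfam
  by_cases hc : ∀ k, c k ≠ 0
  swap
  · -- a zero weight: a joint family of FOUR squares on a `Sing3` space of dimension `5`
    push Not at hc
    obtain ⟨k₀, hk₀⟩ := hc
    exact noJointFamily_five_four W (sing3_of_twoDeadRows W p q fun x hx => (hcol x hx).1) h5 _ _
      (jointFamily_four_of_zero_weight W c k₀ hk₀ β hfam)
  -- transport `(p, q, m) ↦ (0, 1, 3)` keeping the weights
  obtain ⟨σ, hσ0, hσ1⟩ := exists_perm_zero_one p q hpq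
  set τ : Equiv.Perm (Fin 4) := Equiv.swap 3 m with hτ
  have hτ3 : τ 3 = m := by rw [hτ, Equiv.swap_apply_left]
  set Φ : (Fin 4 × Fin 4 → K) ≃ₗ[K] (Fin 4 × Fin 4 → K) :=
    LinearEquiv.funCongrLeft K K (Equiv.prodCongr σ τ) with hΦ
  have hΦa : ∀ (x : Fin 4 × Fin 4 → K) (i j : Fin 4), Φ x (i, j) = x (σ i, τ j) := fun x i j => rfl
  set W' := W.map Φ.toLinearMap with hW'def
  have hfin : finrank K W' = 5 := by rw [hW'def, LinearEquiv.finrank_map_eq, h5]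
  have h20 : (2 : Fin 4) ≠ 0 := by decide
  have h21 : (2 : Fin 4) ≠ 1 := by decide
  have h30 : (3 : Fin 4) ≠ 0 := by decide
  have h31 : (3 : Fin 4) ≠ 1 := by decide
  have hσ2p : σ 2 ≠ p := fun h => h20 (σ.injective (h.trans hσ0.symm))
  have hσ2q : σ 2 ≠ q := fun h => h21 (σ.injective (h.trans hσ1.symm))
  have hσ3p : σ 3 ≠ p := fun h => h30 (σ.injective (h.trans hσ0.symm))
  have hσ3q : σ 3 ≠ q := fun h => h31 (σ.injective (h.trans hσ1.symm))
  have hWc' : ∀ x ∈ W', (∀ j, x (2, j) = 0) ∧ (∀ j, x (3, j) = 0) ∧ x (0, 3) = 0 ∧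
      x (1, 3) = 0 := by
    rintro _ ⟨x, hx, rfl⟩
    obtain ⟨hoff, hpm, hqm⟩ := hcol x hx
    refine ⟨fun j => ?_, fun j => ?_, ?_, ?_⟩
    · show Φ x (2, j) = 0
      rw [hΦa]; exact hoff _ _ hσ2p hσ2q
    · show Φ x (3, j) = 0
      rw [hΦa]; exact hoff _ _ hσ3p hσ3q
    · show Φ x (0, 3) = 0
      rw [hΦa, hσ0, hτ3]; exact hpm
    · show Φ x (1, 3) = 0
      rw [hΦa, hσ1, hτ3]; exact hqm
  obtain ⟨β', hfam'⟩ := jointFamily_map_prodCongr_weights W σ τ c β hfam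
  exact noJointFive_wcol01_of_ne W' hfin hWc' c hc β' hfam'

/-- The same with the tree's predicate `InWCol`. [folklore] -/
theorem noJointFive_of_inWCol' [CharZero K] (W : Submodule K (Fin 4 × Fin 4 → K))
    (h5 : finrank K W = 5) (p q m : Fin 4) (hpq : p ≠ q) (hI : InWCol W p q m)
    (c : Fin 5 → K) (β : Fin 5 → ((Fin 4 × Fin 4 → K) →ₗ[K] (Fin 4 × Fin 4 → K) →ₗ[K] K)) :
    ¬ (∀ u : Fin 4 × Fin 4 → K, ∀ y ∈ W, ∃ e₀ e₁ : K, ∀ s : K,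
      eval (u + s • y) (perPoly (Fin 4) K) = e₀ + s * e₁ + s ^ 2 * ∑ k, c k * (β k u y) ^ 2) :=
  noJointFive_of_inWCol W h5 p q m hpq hI c β

end Summit.ValiantsHypothesis.ValiantsHypothesis.Theorems.SymPencilPerFourWcolHyperplaneFive
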